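import Literature.AlgebraicGeometry.Frobenioids.ArchimedeanIsotropyPropagation
import Literature.AlgebraicGeometry.Frobenioids.ArchimedeanDivisorMaximality
import HarnessLib

/-!
# Frobenioids II, Example 3.3 (ii): isotropic objects of `C` are Frobenius-trivial — PROOF

Mochizuki, *The geometry of Frobenioids II: poly-Frobenioids*, Kyushu J. Math. **62** (2008)
401–460, §3, Example 3.3 (ii), author's text p. 28 [cite: MochizukiFrdII2008, Ex 3.3 (ii) p.28]:
"the following conditions on an object of `C` are equivalent: (a) the object is isotropic; (b) the
object is Frobenius-trivial; (c) the object is Frobenius-ample."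

PROVED here: **(a) ⇒ (b)** (`isFrobeniusTrivial_of_isIsotropic`; with the formal (b) ⇒ (c) of
`ArchimedeanIsotropyPropagation.lean` this gives (a) ⇒ (b) ⇒ (c)). For an isotropic `X` (angular
region the punctured disc of radius `t`) the arrows `ζ_n = (id, n, t^{1-n}) : X → X` are base-identity
endomorphisms of Frobenius degree `n`, isometries (`|t^{1-n}| · t^n = t`), co-angular (every arrow out
of an isotropic object is, `C.isCoAngular_of_isIsotropic`), and multiplicative in `n`
(`t^{1-m} (t^{1-n})^m = t^{1-mn}`): a homomorphism `ζ : ℕ_{≥1} → End_C(X)` splitting `deg_Fr`.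
The converse (c) ⇒ (a) ("a non-isotropic object has no endomorphism of degree `≥ 2`", Lemma 3.2 (iv))
remains with the named statement `Ex33ii_isotropic_iff_frobeniusTrivial`.
-/

namespace Literature.AlgebraicGeometry.Frobenioids

open CategoryTheory Opposite
open scoped Pointwise NNReal

noncomputable section

namespace ArchFrd

namespace C0

variable (X : C0)

/-- The scalar `t^{1-n} = T · T^{-n}` (`T = tip(A_X)` as a positive real unit) of the degree-`n`
Frobenius endomorphism of an isotropic object. [cite: MochizukiFrdII2008, Ex 3.3 (ii) p.28] -/
def frobScalar (n : ℕ+) : ℂˣ := ofPosReal ℂ X.region.tip * (ofPosReal ℂ X.region.tip ^ (n : ℕ))⁻¹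

/-- `|t^{1-n}| · t^n = t`. [cite: MochizukiFrdII2008, Ex 3.3 (ii) p.28] -/
theorem norm_frobScalar_mul (n : ℕ+) : ‖(frobScalar X n : ℂ)‖ * X.tip ^ (n : ℕ) = X.tip := by
  have ht : 0 < X.tip := X.tip_pos
  have hT : ‖((ofPosReal ℂ X.region.tip : ℂˣ) : ℂ)‖ = X.tip := by
    rw [coe_ofPosReal, RCLike.norm_ofReal]; exact abs_of_pos X.region.tip.2
  rw [frobScalar, Units.val_mul, Units.val_inv_eq_inv_val, Units.val_pow_eq_pow_val, norm_mul,
    norm_inv, norm_pow, hT, mul_assoc, inv_mul_cancel₀ (pow_ne_zero _ ht.ne'), mul_one]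

/-- The scalars are real (fixed by every Galois twist). [cite: MochizukiFrdII2008, Ex 3.3 (ii) p.28] -/
theorem frobScalar_mem (n : ℕ+) : frobScalar X n ∈ D0.scalars X.base :=
  mul_mem (ofPosReal_mem_scalars _ _) (inv_mem (pow_mem (ofPosReal_mem_scalars _ _) _))

/-- Multiplicativity `t^{1-mn} = t^{1-n} · (t^{1-m})^n` (the composite law of scalars for
`ζ_n ≫ ζ_m`). [cite: MochizukiFrdII2008, Ex 3.3 (ii) p.28] -/
theorem frobScalar_mul (m n : ℕ+) :
    frobScalar X (m * n) = frobScalar X n * frobScalar X m ^ (n : ℕ) := by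
  simp only [frobScalar, PNat.mul_coe]
  group

variable {X}

/-- The degree-`n` Frobenius endomorphism `ζ_n = (id, n, t^{1-n})` of a naively isotropic object of
`C₀`. [cite: MochizukiFrdII2008, Ex 3.3 (ii) p.28] -/
def frobEndo (hX : X.IsNaivelyIsotropic) (n : ℕ+) : X ⟶ X where
  base := 𝟙 _
  degFr := n
  scalar := frobScalar X n
  scalar_mem := frobScalar_mem X n
  mapsTo := by
    rw [pullRegion_id]
    rintro _ ⟨u, hu, rfl⟩
    rw [mem_carrier_of_isIsotropic hX, ← Subtype.coe_le_coe, coe_absHom]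
    change ‖((frobScalar X n * u : ℂˣ) : ℂ)‖ ≤ X.tip
    rw [Units.val_mul, norm_mul]
    calc ‖(frobScalar X n : ℂ)‖ * ‖(u : ℂ)‖
        ≤ ‖(frobScalar X n : ℂ)‖ * X.tip ^ (n : ℕ) :=
          mul_le_mul_of_nonneg_left (norm_le_of_mem_carrier_pow X.region _ u hu) (norm_nonneg _)
      _ = X.tip := norm_frobScalar_mul X n

/-- `ζ_1 = id`. [cite: MochizukiFrdII2008, Ex 3.3 (ii) p.28] -/
theorem frobEndo_one (hX : X.IsNaivelyIsotropic) : frobEndo hX 1 = 𝟙 X := by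
  refine hom_ext rfl rfl ?_
  change frobScalar X 1 = 1
  rw [frobScalar, PNat.one_coe, pow_one, mul_inv_cancel]

/-- `ζ_{mn} = ζ_n ≫ ζ_m`. [cite: MochizukiFrdII2008, Ex 3.3 (ii) p.28] -/
theorem frobEndo_mul (hX : X.IsNaivelyIsotropic) (m n : ℕ+) :
    frobEndo hX (m * n) = frobEndo hX n ≫ frobEndo hX m := by
  refine hom_ext ?_ ?_ ?_
  · change 𝟙 _ = 𝟙 _ ≫ 𝟙 _; rw [Category.id_comp]
  · change m * n = n * m; rw [mul_comm]
  · rw [scalar_comp']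
    change frobScalar X (m * n) = D0.galAct (D0.Hom.twists (𝟙 X.base)) (frobScalar X m) *
      frobScalar X n ^ (m : ℕ)
    rw [D0.twists_id, D0.galAct_false, mul_comm m n]
    exact frobScalar_mul X n m

/-- `ζ_n` is an isometry. [cite: MochizukiFrdII2008, Ex 3.3 (ii) p.28] -/
theorem isIsometry_frobEndo (hX : X.IsNaivelyIsotropic) (n : ℕ+) :
    PreFrobenioid.IsIsometry C0.toElem (frobEndo hX n) :=
  (A0.isIsometry_iff_norm_mul_tip_pow _).mpr (norm_frobScalar_mul X n)

end C0

universe v u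

variable {D : Type u} [Category.{v} D] (π : D ⥤ D0)

namespace C

variable {π}

/-- `ζ_n` on an object of `C = C₀ ×_{D₀} D` with naively isotropic angular region: `(ζ_n, id)`.
[cite: MochizukiFrdII2008, Ex 3.3 (ii) p.28] -/
def frobEndo (X : C π) (hX : X.fst.IsNaivelyIsotropic) (n : ℕ+) : X ⟶ X :=
  ⟨C0.frobEndo hX n, 𝟙 X.snd, by
    change 𝟙 _ ≫ X.iso.hom = X.iso.hom ≫ π.map (𝟙 X.snd)
    rw [Category.id_comp, CategoryTheory.Functor.map_id, Category.comp_id]⟩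

/-- The homomorphism `ζ : ℕ_{≥1} → End_C(X)`, `n ↦ ζ_n` (Mathlib's `End X` composes `f * g = g ≫ f`).
[cite: MochizukiFrdII2008, Ex 3.3 (ii) p.28] -/
def frobSection (X : C π) (hX : X.fst.IsNaivelyIsotropic) : ℕ+ →* End X where
  toFun n := frobEndo X hX n
  map_one' := by
    change frobEndo X hX 1 = 𝟙 X
    exact CFP.hom_ext (C0.frobEndo_one hX) rfl
  map_mul' m n := by
    change frobEndo X hX (m * n) = frobEndo X hX n ≫ frobEndo X hX m
    refine CFP.hom_ext (C0.frobEndo_mul hX m n) ?_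
    change 𝟙 X.snd = 𝟙 X.snd ≫ 𝟙 X.snd
    rw [Category.id_comp]

end C

/-- **Example 3.3 (ii), (a) ⇒ (b)**: an isotropic object of `C` is Frobenius-trivial — PROVED
(`ζ_n = (id, n, t^{1-n})`: degree `n`, base-identity, isometric, base-isomorphic, and co-angular by
`C.isCoAngular_of_isIsotropic`). [cite: MochizukiFrdII2008, Ex 3.3 (ii) p.28] -/
theorem isFrobeniusTrivial_of_isIsotropic (X : C π) (hX : PreFrobenioid.IsIsotropic (C.toElem π) X) :
    PreFrobenioid.IsFrobeniusTrivial (C.toElem π) X := by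
  have hXn : X.fst.IsNaivelyIsotropic := (Ex33ii_isotropic_iff_holds π X).mp hX
  refine ⟨C.frobSection X hXn, fun n => ⟨rfl, rfl, ⟨?_, ?_⟩, ?_⟩⟩
  · exact C.isCoAngular_of_isIsotropic π _ hX
  · exact C0.isIsometry_frobEndo hXn n
  · change IsIso (𝟙 X.snd)
    infer_instance

/-- **Example 3.3 (ii), (a) ⇒ (c)**: an isotropic object of `C` is Frobenius-ample.
[cite: MochizukiFrdII2008, Ex 3.3 (ii) p.28] -/
theorem isFrobeniusAmple_of_isIsotropic (X : C π) (hX : PreFrobenioid.IsIsotropic (C.toElem π) X) :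
    PreFrobenioid.IsFrobeniusAmple (C.toElem π) X :=
  isFrobeniusAmple_of_isFrobeniusTrivial π (isFrobeniusTrivial_of_isIsotropic π X hX)


end ArchFrd

end

end Literature.AlgebraicGeometry.Frobenioids
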